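import Mathlib
import Summits.KontsevichZagierPeriods.Zeta5Search.SecondOrderLive
import Summits.KontsevichZagierPeriods.Zeta5Search.KDigitResidue
import Summits.KontsevichZagierPeriods.Zeta5Search.DenomLaw.CentreCompanionV
import HarnessLib

/-!
# ζ(5) search — the `𝒦`-HALF of the centre-companion identity (odd `b₀`) and `CentreCompanionOdd` IS A THEOREM (DENOM-LAW D1, prover-d1 gen 15)

HONEST FRAMING: systematic search; no irrationality claim unless certified.  Cell `pub-zeta5`, track «DENOM-LAW» D1, seat `denom-prover-d1`
gen 15 (`denom-law/prover-d1/ATTEMPT-15.md` §5, §9).  Discharges BY NAME `DenomLaw.CentreCompanionOdd` (statement file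
`DenomLaw/CentreCompanion.lean`): the orbit digit-vector of the ODD-CENTRE class of palindromic type `Tc` at odd depth `N ≥ 3` equals that of the
conjugate pair of type `Tc ++ [1]`.  `V`-half: `orbitV_centreCompanion_odd` (`CentreCompanionV.lean`, typer g11's `live_pair`).  `𝒦`-half here
(`orbitK_centreCompanion_odd`): `ĉ` of the centre class is `ĉ₂(T) − (L/2)ĉ(T)` (`cHat_centre_level`), `ĉ` of the companion and of its
conjugate are the type forms of `T ++ [1]` and `1 :: T` (`cHat_level`, the conjugate's levels reversed — `CellKit.netExp_conj_level` + the
palindrome), their sum is `2ĉ₂(T) − Lĉ(T) + corr_C(T)` (`typeC_end_pair`) and `corr_C(T) = 0` by transport of the realised residue identities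
(`typeCCorr_eq_zero_of_companion`); `N` odd makes the orbit sign `+1`.  Identities between explicit rationals; nothing here is about ζ(5); no γ;
records in print UNMOVED.
-/

noncomputable section

open Finset

namespace Summit.KontsevichZagierPeriods.Zeta5Search.DenomLaw

open Summit.KontsevichZagierPeriods.Zeta5Search.CasoratianValuation (InPolytope)
open Summit.KontsevichZagierPeriods.Zeta5Search.ClusterValuation
open Summit.KontsevichZagierPeriods.Zeta5Search.SecondOrder
open Summit.KontsevichZagierPeriods.Zeta5Search.CellKit (conj_level netExp_conj_level)

variable {p : ℕ}

/-- The top level of `T ++ [1]`. -/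
theorem tTop_append_one {T : List ℤ} (hT : T ≠ []) : tTop (T ++ [1]) = tTop T + 1 := by
  unfold tTop; have := List.length_pos_iff.2 hT; simp; omega

/-- The exponent function of `T ++ [1]` is `snocOne` of that of `T`. -/
theorem tList_append_one {T : List ℤ} (hT : T ≠ []) (k : ℕ) : tList (T ++ [1]) k = snocOne (tList T) (tTop T) k := by
  have hlen := List.length_pos_iff.2 hT
  unfold tList snocOne tTop
  simp only [List.getD_eq_getElem?_getD]
  rcases Nat.lt_trichotomy k T.length with h | h | h
  · rw [List.getElem?_append_left h, if_neg (by omega)]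
  · subst h
    rw [List.getElem?_append_right (le_refl _), Nat.sub_self, if_pos (by omega)]; simp
  · rw [if_neg (by omega), List.getElem?_eq_none_iff.2 (by simp; omega), List.getElem?_eq_none_iff.2 (by omega)]

/-- **`𝒦`-half of `CentreCompanionOdd`**: under its hypotheses, `orbitK b p N x = orbitK b p N y`. -/
theorem orbitK_centreCompanion_odd [hp : Fact p.Prime] (b : ℕ → ℤ) (N x y : ℕ) (Tc : List ℤ) (hb : InPolytope b)
    (hp5 : 5 ≤ p) (hpb : (p : ℤ) ≤ b 0) (hwin : (b 0 + 2 : ℤ) < (p : ℤ) ^ 2) (hodd : ¬ (2 : ℤ) ∣ b 0) (h3N : 3 ≤ N) (hN : ¬ 2 ∣ N)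
    (hx : x < p) (hy : y < p)
    (hxpole : 2 ≤ classPoleCount b p x) (hxcen : CentreIn b p x) (hxE : classExp b p x = -(N : ℤ)) (hxT : classTypeList b p x = Tc)
    (hTc : Tc.reverse = Tc) (hypole : 2 ≤ classPoleCount b p y) (hycen : ¬ CentreIn b p y) (hyE : classExp b p y = -(N : ℤ))
    (hyT : classTypeList b p y = Tc ++ [1]) :
    orbitK b p N x = orbitK b p N y := by
  have h0 : 0 ≤ b 0 := hb.1.1
  have hxn := le_b0_of_lt b hpb hx
  have hyn := le_b0_of_lt b hpb hy
  -- `Tc` is non-empty (the class of `x` has a pole)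
  have hTne : Tc ≠ [] := by
    intro h; rw [h] at hxT
    have := congrArg List.length hxT
    simp [classTypeList] at this
  -- level data of the centre class
  obtain ⟨hxL, hxL'⟩ := level_bounds' (p := p) b hxn
  obtain ⟨htopx, hex⟩ := spec_of_typeList b hxn hxT
  set L := topLevel b p x with hLdef
  set e : ℕ → ℤ := tList Tc with hedef
  have htopTc : tTop Tc = L := htopx
  -- level data of the companion class: top level `L + 1`, exponents `snocOne e L`
  obtain ⟨hyL0, hyL0'⟩ := level_bounds' (p := p) b hyn
  obtain ⟨htopy, hey0⟩ := spec_of_typeList b hyn hyT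
  have hMy : topLevel b p y = L + 1 := by rw [← htopy, tTop_append_one hTne, htopTc]
  rw [hMy] at hyL0 hyL0' hey0
  have hey : ∀ k ≤ L + 1, netExp b (y + k * p) = snocOne e L k := fun k hk => by
    rw [hey0 k hk, tList_append_one hTne, htopTc]
  -- the conjugate class: exponents `consOne e` (reverse of `snocOne e L` for the palindrome `e`)
  obtain ⟨hy', hyL2, hyL2'⟩ := conj_level b hy hyL0 hyL0'
  have hpal := tList_pal hTc
  have heyc : ∀ k ≤ L + 1, netExp b (conjClass b p y + k * p) = consOne e k := fun k hk => by
    rw [netExp_conj_level b hyL0 hyL0' h0 hk, hey (L + 1 - k) (by omega), snocOne, consOne]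
    by_cases hk0 : k = 0
    · rw [if_pos (by omega), if_pos hk0]
    · rw [if_neg (by omega), if_neg hk0, show L + 1 - k = tTop Tc - (k - 1) by omega, hedef, hpal (k - 1) (by omega)]
  have hycc : ¬ CentreIn b p (conjClass b p y) := fun h => hycen ((centreIn_conj_iff b h0 hyn).1 h)
  have hycpole : 2 ≤ classPoleCount b p (conjClass b p y) := by rw [classPoleCount_conj b h0 hyn]; exact hypole
  -- the three `ĉ`
  have hcx : cHat b p x = typeC2 L e - (L : ℚ) / 2 * typeC L e := cHat_centre_level b hx hxL hxL' hodd hxcen hb e hex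
  have hcy : cHat b p y = typeC (L + 1) (snocOne e L) := SecondOrder.cHat_level b hy hyL0 hyL0' _ hey hycen
  have hcyc : cHat b p (conjClass b p y) = typeC (L + 1) (consOne e) := SecondOrder.cHat_level b hy' hyL2 hyL2' _ heyc hycc
  -- the translation term vanishes
  have hcorr : typeCCorr L e = 0 :=
    typeCCorr_eq_zero_of_companion b hb hp5 hwin hx hxL hxL' hodd hxcen (by rw [hxE]; omega) hy hyL0 hyL0' hycen
      (by rw [hyE]; omega) e hex hey
  -- assembly
  have hsum := typeC_end_pair L e
  rw [hcorr, add_zero] at hsum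
  unfold orbitK sigmaK
  rw [if_pos hxcen, if_pos hxpole, if_neg hycen, if_pos hypole, if_pos hycpole, neg_one_pow_succ_of_odd hN, one_mul, hcx, hcy,
    hcyc, hsum]
  ring

/-- **`DenomLaw.CentreCompanionOdd` IS A THEOREM.** -/
theorem centreCompanionOdd_holds : CentreCompanionOdd := by
  intro b p N x y Tc hb hprime hp5 hpb hwin hodd h3N hN hx hy hxpole hxcen hxE hxT hTc hypole hycen hyE hyT
  haveI : Fact p.Prime := ⟨hprime⟩
  exact ⟨orbitK_centreCompanion_odd b N x y Tc hb hp5 hpb hwin hodd h3N hN hx hy hxpole hxcen hxE hxT hTc hypole hycen hyE hyT,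
    orbitV_centreCompanion_odd b N x y Tc hb hpb hodd hN hx hy hxpole hxcen hxE hxT hTc hypole hycen hyE hyT⟩

end Summit.KontsevichZagierPeriods.Zeta5Search.DenomLaw

end
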